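import Literature.Combinatorics.Designs.SequenceSumSquares

/-!
# Hadamard 668 census — the sum-of-squares TYPES of the T-sequence family at `v = 167`, certified in the kernel

Framing: lottery ticket; floor = certified bounds/negative ranges.

Cell pub-namedobj (venture DiscreteObjects), target (H).  The first branching of any search for `TT(56)`,
`BS(84, 84, 83, 83)` or T-sequences of length `167` is over the possible element sums (row sums) of the sequences.
From the kernel grammar (`SequenceSumSquares`: SY 2020 Lemma 1.19, BDKR 2013 eq. (1)) and the parity of a `±1` sum
(`sum_pm_parity`: a `±1` sum of length `L` is `L - 2k`), the absolute element sums are confined to finite TYPE TABLES,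
each certified complete by `decide +kernel` over the bounded box:
* `TT(56)`: `x² + y² + 2z² + 2w² = 334`, `x, y, z` even, `w` odd ⇒ `[min |x| |y|, max |x| |y|, |z|, |w|]` is one of the
  12 types `tt56Types` (`turynType56_type`);
* `BS(84, 84, 83, 83)`: `a² + b² + c² + d² = 334`, `a, b` even, `c, d` odd ⇒ `[min |a| |b|, max |a| |b|, min |c| |d|,
  max |c| |d|]` is one of the 12 types `bs8483Types` (`baseSeq_84_83_type`);
* T-sequences of length `167`: `t₁² + t₂² + t₃² + t₄² = 167` ⇒ the sorted absolute sums are one of the 5 types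
  `t167Types` (`tSeq167_type`).
The same tables were produced by an exact script (FAMILY-F5-G24.md §4, E1); this file is the kernel's second engine.
Typed grammar of hypothetical objects only; nothing is asserted to exist; HITS 0.  No `sorry`, no `native_decide`.
-/

open Finset BigOperators

namespace Summit.Ventures.DiscreteObjects.Hadamard

open Literature.Combinatorics.Designs.TSequences
open Literature.Combinatorics.Designs.BaseSequences
open Literature.Combinatorics.Designs.SequenceSums

/-! ## Parity of a `±1` sum -/

/-- a `±1` sum of length `L` has the parity of `L`: `Σ_{i<L} x i = L - 2k` for some integer `k`. -/
theorem sum_pm_parity {x : ℕ → ℤ} : ∀ {L : ℕ}, PMOn L x → ∃ k : ℤ, ∑ i ∈ range L, x i = L - 2 * k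
  | 0, _ => ⟨0, by simp⟩
  | L + 1, hx => by
      obtain ⟨k, hk⟩ := sum_pm_parity (L := L) fun i hi => hx i (Nat.lt_succ_of_lt hi)
      rw [Finset.sum_range_succ, hk]
      rcases hx L (Nat.lt_succ_self L) with h | h
      · exact ⟨k, by rw [h]; push_cast; ring⟩
      · exact ⟨k + 1, by rw [h]; push_cast; ring⟩

/-- the absolute value of `L - 2k` has the parity of `L`. -/
private lemma natAbs_mod_two {X k : ℤ} {L : ℕ} (h : X = L - 2 * k) : X.natAbs % 2 = L % 2 := by
  rcases Int.natAbs_eq X with e | e <;> omega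

/-- `(|X| : ℤ)² = X²`. -/
private lemma natAbs_sq_cast (X : ℤ) : ((X.natAbs : ℕ) : ℤ) ^ 2 = X ^ 2 := by
  rw [Int.natCast_natAbs, sq_abs]

/-! ## The three type tables and their completeness over the box (kernel enumeration) -/

/-- the 12 types `[min |x| |y|, max |x| |y|, |z|, |w|]` for `TT(56)` (4-element lists). -/
def tt56Types : List (List ℕ) :=
  [[0, 6, 10, 7], [0, 10, 6, 9], [0, 18, 2, 1], [2, 4, 6, 11], [2, 16, 6, 1], [4, 10, 10, 3], [4, 14, 6, 5],
    [6, 8, 6, 9], [8, 10, 2, 9], [8, 10, 6, 7], [8, 14, 6, 1], [10, 12, 6, 3]]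

/-- the 12 types `[min |a| |b|, max |a| |b|, min |c| |d|, max |c| |d|]` for `BS(84, 84, 83, 83)` (4-element lists). -/
def bs8483Types : List (List ℕ) :=
  [[0, 6, 3, 17], [0, 10, 3, 15], [0, 18, 1, 3], [2, 4, 5, 17], [2, 16, 5, 7], [4, 10, 7, 13], [4, 14, 1, 11],
    [6, 8, 3, 15], [8, 10, 1, 13], [8, 10, 7, 11], [8, 14, 5, 7], [10, 12, 3, 9]]

/-- the 5 sorted types of `(|t₁|, |t₂|, |t₃|, |t₄|)` for T-sequences of length `167` (`167` as a sum of four squares). -/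
def t167Types : List (List ℕ) :=
  [[1, 2, 9, 9], [1, 3, 6, 11], [1, 6, 7, 9], [3, 3, 7, 10], [5, 5, 6, 9]]

/-- completeness of `tt56Types`: every solution of `(2a)² + (2b)² + 2(2c)² + 2(2d+1)² = 334` in the box is listed
(by kernel enumeration over `Fin 10 × Fin 10 × Fin 7 × Fin 7`). -/
theorem tt56Types_complete : ∀ a b : Fin 10, ∀ c d : Fin 7,
    (2 * a.val) ^ 2 + (2 * b.val) ^ 2 + 2 * (2 * c.val) ^ 2 + 2 * (2 * d.val + 1) ^ 2 = 334 →
    [min (2 * a.val) (2 * b.val), max (2 * a.val) (2 * b.val), 2 * c.val, 2 * d.val + 1] ∈ tt56Types := by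
  decide +kernel

/-- completeness of `bs8483Types`: every solution of `(2a)² + (2b)² + (2c+1)² + (2d+1)² = 334` in the box is listed
(kernel enumeration over `Fin 10 × Fin 10 × Fin 9 × Fin 9`). -/
theorem bs8483Types_complete : ∀ a b : Fin 10, ∀ c d : Fin 9,
    (2 * a.val) ^ 2 + (2 * b.val) ^ 2 + (2 * c.val + 1) ^ 2 + (2 * d.val + 1) ^ 2 = 334 →
    [min (2 * a.val) (2 * b.val), max (2 * a.val) (2 * b.val), min (2 * c.val + 1) (2 * d.val + 1),
      max (2 * c.val + 1) (2 * d.val + 1)] ∈ bs8483Types := by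
  decide +kernel

/-- completeness of `t167Types`: every solution of `a² + b² + c² + d² = 167` in the box has its sorted tuple listed
(kernel enumeration over `Fin 13⁴`). -/
theorem t167Types_complete : ∀ a b c d : Fin 13,
    a.val ^ 2 + b.val ^ 2 + c.val ^ 2 + d.val ^ 2 = 167 →
    ([a.val, b.val, c.val, d.val].insertionSort (· ≤ ·)) ∈ t167Types := by
  decide +kernel

/-! ## The type theorems -/

/-- **TT(56) type table**: for Turyn-type sequences `TT(56)` with element sums `X, Y, Z, W`, the list
`[min |X| |Y|, max |X| |Y|, |Z|, |W|]` is one of the 12 entries of `tt56Types`. -/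
theorem turynType56_type {x y z w : ℕ → ℤ} (h : IsTurynType 56 x y z w) :
    [min (∑ i ∈ range 56, x i).natAbs (∑ i ∈ range 56, y i).natAbs,
      max (∑ i ∈ range 56, x i).natAbs (∑ i ∈ range 56, y i).natAbs,
      (∑ i ∈ range 56, z i).natAbs, (∑ i ∈ range 55, w i).natAbs] ∈ tt56Types := by
  have hsq := turynType_sum_sq h (by norm_num)
  norm_num at hsq
  obtain ⟨hx, hy, hz, hw, -⟩ := h
  obtain ⟨kx, hkx⟩ := sum_pm_parity hx
  obtain ⟨ky, hky⟩ := sum_pm_parity hy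
  obtain ⟨kz, hkz⟩ := sum_pm_parity hz
  obtain ⟨kw, hkw⟩ := sum_pm_parity hw
  have pX := natAbs_mod_two hkx
  have pY := natAbs_mod_two hky
  have pZ := natAbs_mod_two hkz
  have pW := natAbs_mod_two hkw
  norm_num at pX pY pZ pW
  generalize (∑ i ∈ range 56, x i) = X at *
  generalize (∑ i ∈ range 56, y i) = Y at *
  generalize (∑ i ∈ range 56, z i) = Z at *
  generalize (∑ i ∈ range 55, w i) = W at *
  have hN : X.natAbs ^ 2 + Y.natAbs ^ 2 + 2 * Z.natAbs ^ 2 + 2 * W.natAbs ^ 2 = 334 := by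
    have : ((X.natAbs : ℕ) : ℤ) ^ 2 + ((Y.natAbs : ℕ) : ℤ) ^ 2 + 2 * ((Z.natAbs : ℕ) : ℤ) ^ 2 +
        2 * ((W.natAbs : ℕ) : ℤ) ^ 2 = 334 := by
      rw [natAbs_sq_cast, natAbs_sq_cast, natAbs_sq_cast, natAbs_sq_cast]; linarith
    exact_mod_cast this
  obtain ⟨a, ha⟩ : ∃ a, X.natAbs = 2 * a := ⟨X.natAbs / 2, by omega⟩
  obtain ⟨b, hb⟩ : ∃ b, Y.natAbs = 2 * b := ⟨Y.natAbs / 2, by omega⟩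
  obtain ⟨c, hc⟩ : ∃ c, Z.natAbs = 2 * c := ⟨Z.natAbs / 2, by omega⟩
  obtain ⟨d, hd⟩ : ∃ d, W.natAbs = 2 * d + 1 := ⟨W.natAbs / 2, by omega⟩
  rw [ha, hb, hc, hd] at hN ⊢
  have ha' : a < 10 := by nlinarith
  have hb' : b < 10 := by nlinarith
  have hc' : c < 7 := by nlinarith
  have hd' : d < 7 := by nlinarith
  exact tt56Types_complete ⟨a, ha'⟩ ⟨b, hb'⟩ ⟨c, hc'⟩ ⟨d, hd'⟩ hN

/-- **BS(84, 84, 83, 83) type table**: the list `[min |A| |B|, max |A| |B|, min |C| |D|, max |C| |D|]` of absolute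
element sums is one of the 12 entries of `bs8483Types`. -/
theorem baseSeq_84_83_type {a b c d : ℕ → ℤ} (h : IsBaseSeq 84 83 a b c d) :
    [min (∑ i ∈ range 84, a i).natAbs (∑ i ∈ range 84, b i).natAbs,
      max (∑ i ∈ range 84, a i).natAbs (∑ i ∈ range 84, b i).natAbs,
      min (∑ i ∈ range 83, c i).natAbs (∑ i ∈ range 83, d i).natAbs,
      max (∑ i ∈ range 83, c i).natAbs (∑ i ∈ range 83, d i).natAbs] ∈ bs8483Types := by
  have hsq := baseSeq_sum_sq h
  norm_num at hsq
  obtain ⟨ha, hb, hc, hd, -⟩ := h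
  obtain ⟨ka, hka⟩ := sum_pm_parity ha
  obtain ⟨kb, hkb⟩ := sum_pm_parity hb
  obtain ⟨kc, hkc⟩ := sum_pm_parity hc
  obtain ⟨kd, hkd⟩ := sum_pm_parity hd
  have pA := natAbs_mod_two hka
  have pB := natAbs_mod_two hkb
  have pC := natAbs_mod_two hkc
  have pD := natAbs_mod_two hkd
  norm_num at pA pB pC pD
  generalize (∑ i ∈ range 84, a i) = A at *
  generalize (∑ i ∈ range 84, b i) = B at *
  generalize (∑ i ∈ range 83, c i) = C at *
  generalize (∑ i ∈ range 83, d i) = D at *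
  have hN : A.natAbs ^ 2 + B.natAbs ^ 2 + C.natAbs ^ 2 + D.natAbs ^ 2 = 334 := by
    have : ((A.natAbs : ℕ) : ℤ) ^ 2 + ((B.natAbs : ℕ) : ℤ) ^ 2 + ((C.natAbs : ℕ) : ℤ) ^ 2 +
        ((D.natAbs : ℕ) : ℤ) ^ 2 = 334 := by
      rw [natAbs_sq_cast, natAbs_sq_cast, natAbs_sq_cast, natAbs_sq_cast]; linarith
    exact_mod_cast this
  obtain ⟨a', ha'⟩ : ∃ a', A.natAbs = 2 * a' := ⟨A.natAbs / 2, by omega⟩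
  obtain ⟨b', hb'⟩ : ∃ b', B.natAbs = 2 * b' := ⟨B.natAbs / 2, by omega⟩
  obtain ⟨c', hc'⟩ : ∃ c', C.natAbs = 2 * c' + 1 := ⟨C.natAbs / 2, by omega⟩
  obtain ⟨d', hd'⟩ : ∃ d', D.natAbs = 2 * d' + 1 := ⟨D.natAbs / 2, by omega⟩
  rw [ha', hb', hc', hd'] at hN ⊢
  have h1 : a' < 10 := by nlinarith
  have h2 : b' < 10 := by nlinarith
  have h3 : c' < 9 := by nlinarith
  have h4 : d' < 9 := by nlinarith
  exact bs8483Types_complete ⟨a', h1⟩ ⟨b', h2⟩ ⟨c', h3⟩ ⟨d', h4⟩ hN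

/-- **T-sequences of length 167, type table**: the sorted absolute element sums `(|t₁|, |t₂|, |t₃|, |t₄|)` form one of
the 5 entries of `t167Types` (`167 = 1+4+81+81 = 1+9+36+121 = 1+36+49+81 = 9+9+49+100 = 25+25+36+81`). -/
theorem tSeq167_type {t : Fin 4 → ℕ → ℤ} (ht : IsTSeq 167 t) :
    ([(∑ i ∈ range 167, t 0 i).natAbs, (∑ i ∈ range 167, t 1 i).natAbs, (∑ i ∈ range 167, t 2 i).natAbs,
        (∑ i ∈ range 167, t 3 i).natAbs].insertionSort (· ≤ ·)) ∈ t167Types := by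
  have hsq := tseq_sum_sq ht
  rw [Fin.sum_univ_four] at hsq
  push_cast at hsq
  generalize (∑ i ∈ range 167, t 0 i) = T0 at *
  generalize (∑ i ∈ range 167, t 1 i) = T1 at *
  generalize (∑ i ∈ range 167, t 2 i) = T2 at *
  generalize (∑ i ∈ range 167, t 3 i) = T3 at *
  have hN : T0.natAbs ^ 2 + T1.natAbs ^ 2 + T2.natAbs ^ 2 + T3.natAbs ^ 2 = 167 := by
    have : ((T0.natAbs : ℕ) : ℤ) ^ 2 + ((T1.natAbs : ℕ) : ℤ) ^ 2 + ((T2.natAbs : ℕ) : ℤ) ^ 2 +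
        ((T3.natAbs : ℕ) : ℤ) ^ 2 = 167 := by
      rw [natAbs_sq_cast, natAbs_sq_cast, natAbs_sq_cast, natAbs_sq_cast]; linarith
    exact_mod_cast this
  have h0 : T0.natAbs < 13 := by nlinarith
  have h1 : T1.natAbs < 13 := by nlinarith
  have h2 : T2.natAbs < 13 := by nlinarith
  have h3 : T3.natAbs < 13 := by nlinarith
  exact t167Types_complete ⟨_, h0⟩ ⟨_, h1⟩ ⟨_, h2⟩ ⟨_, h3⟩ hN

end Summit.Ventures.DiscreteObjects.Hadamard
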